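import Literature.NumberTheory.ComplexMultiplication.ReflexDegreeQuadraticSubfieldBound
import Mathlib.GroupTheory.GroupAction.SubMulAction.Combination
import HarnessLib

/-!
# CM types over an imaginary quadratic subfield when `Gal(K₀ᶜ/ℚ) ⊇ Aₙ`: the EXACT rank (`n + 1` for
# unbalanced weight, `n` for weight `n/2`), primitivity, the number of translates — Dodson 1987, Prop. 2.1

B. Dodson, *On the Mumford–Tate group of an abelian variety with complex multiplication*, J. Algebra **111**
(1987) 49–73 [Dodson1987] (held text `paper:doi-10-1016-0021-8693-87-90242-0`, p. 58 L38 – p. 59 L8):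

> "PROPOSITION 2.1. Let `n` be odd and suppose that `K` is a CM-field of degree `2n` such that the maximal
> totally real subfield `K₀` has `Gal(K₀ᶜ/ℚ) ≅ Aₙ`, or `Sₙ`.  Then every primitive CM-type `(K, Φ)` is
> nondegenerate.  *Proof.* … either there is a single `Gal(Kᶜ/ℚ)`-orbit of types of order `2ⁿ`, in which case
> `Rank(Φ) = n + 1` is clear, or else `K` contains an imaginary quadratic subfield.  In the latter case, we take
> `s` to be identically `0`, as usual, and note that in the action on types `e = 0` or `ρ`.  Then … for `n > 1`
> there are only `(n − 1)/2` orbits of primitive types, where each orbit corresponds to `f ∈ ℤ₂ⁿ` having a fixed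
> number of nonzero coordinates.  For an orbit with `k` nonzero coordinates, `1 ≤ k ≤ (n − 1)/2`, we select the
> `n` vectors … and observe that they are linearly independent in `ℤ[ℤ₂ⁿ]`.  Then we conclude that
> `Rank(f) = n + 1` by the Constant Weight Criterion [8]."

The Constant Weight Criterion is B. Dodson, Trans. AMS **283** (1984) [Dodson1984] §3.1.1 (held text
`paper:doi-10-2307-1999987`, pp. 11–12): for `K ⊇ D` imaginary quadratic, `G = ⟨ρ⟩ × G₀`, a type `Φ = Φᶠ` with
`f ∈ (ℤ₂)ⁿ` of weight `w` and `r` = the rank of the `G₀`-orbit of `f`: "`t(Φ) = r + 1`, unless the weight of `f` is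
`n/2`, in which case `t(Φ) = r` may also occur" — in the tree in the exact form `t + [2w = n] = r + 1 + [w = 0]`
(`ConstantWeightCriterionQuadraticSubfield`, with `r` left symbolic).  Dodson 1984, p. 1: "The Theorem of §3.1.1
reduces the calculation of the rank to linear algebra when `K` has an imaginary quadratic subfield, a case
emphasized in this context by Weil [24]" (= [Weil1977HodgeRing]).

## What this file proves (theorems only; no definition, no named fact — D-0014/D-0026)

This is the SECOND case of Dodson's proof ("`K` contains an imaginary quadratic subfield"), made EXACT and for
EVERY weight, in the tree's group-level carrier (W) of `CMTypeRank.lean` (`G` acting on the embeddings `E`,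
`ρ` the conjugation, `Φ` a CM type: `IsCMTypeWith ρ Φ`; the imaginary quadratic subfield is a block `E₀` — a CM
type with `gE₀ ∈ {E₀, ρE₀}` for all `g`, `G₀ = Stab(E₀)`, `n = |E₀|`, `f = E₀ ∖ Φ`, `w = |f|`):

* **`typeRank_stabilizer_eq_ncard_of_forall_exists_smul_set_eq`** — Dodson's `r` equals `n` as soon as `G₀` moves
  `f` onto EVERY `w`-subset of the block (`0 < w < n`): the indicators of all `w`-subsets of an `n`-set span `ℚⁿ`
  (`translateInd_singleton_mem_of_forall_ncard`: `e_u − e_v = 𝟙_{R ⊔ u} − 𝟙_{R ⊔ v}`, `w·e_x = 𝟙_T + Σ_{t ∈ T}(e_x − e_t)`).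
* **`IsCMTypeWith.typeRank_eq_of_forall_exists_smul_set_eq`** (`2w ≠ n` ⟹ `t(Φ) = n + 1`, NONDEGENERATE) and
  **`….typeRank_eq_of_forall_exists_smul_set_eq_of_balanced`** (`2w = n` ⟹ `t(Φ) = n` EXACTLY — Dodson's "may also
  occur" does occur, with corank exactly one; these are Weil's 1977 types balanced over the imaginary quadratic
  subfield, whose realisations are of Weil type over `D`).
* **`….isPrimitive_of_forall_exists_smul_set_eq`** — such a type (`0 < w < n`, `n ≥ 3`) is PRIMITIVE: every `w`-subset
  of the block is a trace `{z ∈ E₀ | gz ∈ Φ}` (`exists_forall_smul_mem_iff_of_forall_exists_smul_set_eq`), and these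
  separate the embeddings (Shimura's criterion, tree `isPrimitive_iff_forall_eq`); the two types `E₀`, `ρE₀` of the
  block are not primitive and a primitive type has `0 < w < n` (`not_isPrimitive_block`,
  `not_subset_and_inter_nonempty_of_isPrimitive`).
* **`….card_orbit_eq_choose_add_choose_of_forall_exists_smul_set_eq`** / **`….card_orbit_eq_choose_of_…`** — the number
  of translates (`= [K′(Φ) : ℚ]`, Dodson 1984 §1.3 Remark) is EXACTLY `C(n,a) + C(n,b)` (`a = n − w ≠ b = w`) resp.
  `C(n, n/2)`: equality in the tree's bound `card_orbit_le_choose_add_choose` ("the `G`-orbit of `f` is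
  `G₀*(f) ∪ G₀*(ρf)`"); the terms of the partition `2ⁿ = Σᵢ [K′ᵢ : ℚ]` for "`⟨ρ⟩ × Sₙ`" (Dodson 1984 §4.0).
* **`exists_mem_stabilizer_smul_set_eq_of_alternatingGroup_le`** — if the image of `G₀` in `Sym(E₀)` contains the
  alternating group and `n ≥ 3`, `G₀` is `k`-homogeneous on the block for every `k` (Mathlib
  `Set.powersetCard.isPretransitive_alternatingGroup`); **`IsCMTypeWith.alternatingGroup_le_range_of_factorial_dvd`** —
  this holds as soon as `n! ∣ |G|` (`G₀ ↪ Sym(E₀)` has index `≤ 2`; "`Gal(K₀ᶜ/ℚ) ≅ Aₙ, or Sₙ`").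
* Packaged under `n! ∣ |G|`, `n ≥ 3` (section `Factorial`): `typeRank_eq_of_factorial_dvd` (`2w ≠ n` ⟹ rank `n + 1`),
  `typeRank_eq_of_factorial_dvd_of_balanced` (`2w = n` ⟹ rank `n`), `isPrimitive_of_factorial_dvd`,
  **`typeRank_eq_iff_of_isPrimitive_of_factorial_dvd`** (primitive: nondegenerate ⟺ `2w ≠ n`) and
  **`typeRank_eq_of_isPrimitive_of_factorial_dvd_of_odd`** — **Prop. 2.1: `n` odd ⟹ every primitive type is
  nondegenerate**; `card_orbit_eq_choose_add_choose_of_factorial_dvd`, `card_orbit_eq_choose_of_factorial_dvd`.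

The number-field dress (`K` a CM field with an imaginary quadratic subfield, `L = Kᶜ`, `n! ∣ [Kᶜ : ℚ]`,
Pohlmann's `cmTypeRank` / `IsNondegenerate` / `IsPrimitive (ℂ ≃+* ℂ)`) is the sequel
`CMTypeRankAlternatingOverImaginaryQuadratic.lean`.  The FIRST case of Dodson's proof (no imaginary quadratic
subfield ⟹ a single orbit of `2ⁿ` types ⟹ nondegenerate) is the tree's `ReflexDegreeMaximal`
(`typeRank_eq_of_card_pairKernel_eq`); the dichotomy itself (for `Gal(K₀ᶜ/ℚ) ⊇ Aₙ`, `n` odd: `v ∈ {1, n}` and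
`v = 1` forces an imaginary quadratic subfield) is not typed here.

## References

* [Dodson1987] B. Dodson, J. Algebra 111 (1987) 49–73: Prop. 2.1 and its proof (pp. 58–59); §1.1 (rank, p. 50).
* [Dodson1984] B. Dodson, Trans. AMS 283 (1984) 1–32: §3.1.0–§3.1.1 (pp. 11–12), §1.3 Remark (p. 5), §4.0 (p. 17).
* [Weil1977HodgeRing] A. Weil, *Abelian varieties and the Hodge ring* (1977), Œuvres III 421–429 — Dodson's [24].
* [Shimura1998] G. Shimura, *Abelian varieties with complex multiplication and modular functions*, §8.2 Prop. 26.
-/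

set_option autoImplicit false

open scoped Pointwise BigOperators

namespace Literature.NumberTheory.ComplexMultiplication

/-! ## Part I — group level -/

section GroupLevel

variable {G : Type*} [Group G] {E : Type*} [MulAction G E] {ρ : G} {Φ E₀ : Set E}

/-! ### Linear algebra: the indicators of ALL `w`-subsets of an `n`-set span an `n`-dimensional space -/

open scoped Classical in
/-- The indicator of `T` as the translate-indicator `translateInd T 1` (Dodson's characteristic function of the
type `Φ¹ = Φ`). [cite: Dodson1987, §1.1 (p. 50)] -/
theorem translateInd_one_apply (T : Set E) (y : E) :
    translateInd T (1 : G) y = if y ∈ T then 1 else 0 := by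
  by_cases hy : y ∈ T
  · rw [if_pos hy]; exact translateInd_of_mem (by rwa [one_smul])
  · rw [if_neg hy]; exact translateInd_of_not_mem (by rwa [one_smul])

/-- `𝟙[m⁻¹ · ∈ f] = 𝟙_{m • f}`: the characteristic function of the translate `Φᵍ`. [cite: Dodson1987, §1.1 (p. 50)] -/
theorem translateInd_inv_eq_of_smul_set_eq {f T : Set E} {m : G} (hm : m • f = T) :
    translateInd f m⁻¹ = translateInd T (1 : G) := by
  funext y
  by_cases hy : y ∈ T
  · rw [translateInd_of_mem (Φ := T) (by rwa [one_smul]),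
      translateInd_of_mem (Φ := f) (by rwa [← Set.mem_smul_set_iff_inv_smul_mem, hm])]
  · rw [translateInd_of_not_mem (Φ := T) (by rwa [one_smul]),
      translateInd_of_not_mem (Φ := f) (by rwa [← Set.mem_smul_set_iff_inv_smul_mem, hm])]

/-- `𝟙_T(y) = 1` for `y ∈ T` (value of the characteristic function). [cite: Dodson1987, §1.1 (p. 50)] -/
theorem translateInd_one_of_mem {T : Set E} {y : E} (hy : y ∈ T) : translateInd T (1 : G) y = 1 :=
  translateInd_of_mem (by rwa [one_smul])

/-- `𝟙_T(y) = 0` for `y ∉ T` (value of the characteristic function). [cite: Dodson1987, §1.1 (p. 50)] -/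
theorem translateInd_one_of_not_mem {T : Set E} {y : E} (hy : y ∉ T) : translateInd T (1 : G) y = 0 :=
  translateInd_of_not_mem (by rwa [one_smul])

/-- The indicator of a singleton is the standard basis vector `φᵢ` of Dodson's free module `ℤ[φ₁, φ̄₁, …, φₙ, φ̄ₙ]`.
[cite: Dodson1987, §1.1 (p. 50)] -/
theorem translateInd_singleton_one (x : E) [DecidableEq E] :
    translateInd ({x} : Set E) (1 : G) = Pi.single x (1 : ℚ) := by
  funext y
  rw [Pi.single_apply]
  by_cases h : y = x
  · rw [if_pos h, translateInd_one_of_mem (by rw [h]; rfl)]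
  · rw [if_neg h, translateInd_one_of_not_mem (by rwa [Set.mem_singleton_iff])]

/-- The difference of the indicators of `insert u R` and `insert v R` (`u, v ∉ R`, `u ≠ v`) is `e_u − e_v`.
[folklore] -/
private theorem translateInd_insert_sub_translateInd_insert {R : Set E} {u v : E} (hu : u ∉ R) (hv : v ∉ R)
    (huv : u ≠ v) :
    translateInd (insert u R) (1 : G) - translateInd (insert v R) (1 : G) =
      translateInd ({u} : Set E) (1 : G) - translateInd ({v} : Set E) (1 : G) := by
  funext y
  simp only [Pi.sub_apply]
  by_cases hyu : y = u
  · subst hyu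
    rw [translateInd_one_of_mem (Set.mem_insert y R), translateInd_one_of_mem (Set.mem_singleton y),
      translateInd_one_of_not_mem (by rw [Set.mem_insert_iff]; push Not; exact ⟨huv, hu⟩),
      translateInd_one_of_not_mem (by rwa [Set.mem_singleton_iff])]
  · by_cases hyv : y = v
    · subst hyv
      rw [translateInd_one_of_mem (Set.mem_insert y R), translateInd_one_of_mem (Set.mem_singleton y),
        translateInd_one_of_not_mem (by rw [Set.mem_insert_iff]; push Not; exact ⟨hyu, hv⟩),
        translateInd_one_of_not_mem (by rwa [Set.mem_singleton_iff])]
    · rw [translateInd_one_of_not_mem (show y ∉ ({u} : Set E) by rwa [Set.mem_singleton_iff]),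
        translateInd_one_of_not_mem (show y ∉ ({v} : Set E) by rwa [Set.mem_singleton_iff])]
      by_cases hyR : y ∈ R
      · rw [translateInd_one_of_mem (Set.mem_insert_of_mem u hyR),
          translateInd_one_of_mem (Set.mem_insert_of_mem v hyR), sub_self, sub_self]
      · rw [translateInd_one_of_not_mem (by rw [Set.mem_insert_iff]; push Not; exact ⟨hyu, hyR⟩),
          translateInd_one_of_not_mem (by rw [Set.mem_insert_iff]; push Not; exact ⟨hyv, hyR⟩), sub_zero]

/-- `Σ_{t ∈ T} e_t = 𝟙_T` pointwise, for a finset `T`. [folklore] -/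
private theorem sum_translateInd_singleton_apply (Tf : Finset E) (y : E) :
    ∑ t ∈ Tf, translateInd ({t} : Set E) (1 : G) y = translateInd (Tf : Set E) (1 : G) y := by
  by_cases hy : y ∈ Tf
  · rw [translateInd_one_of_mem (Finset.mem_coe.2 hy), Finset.sum_eq_single_of_mem y hy fun t _ hty =>
      translateInd_one_of_not_mem (by rw [Set.mem_singleton_iff]; exact Ne.symm hty)]
    exact translateInd_one_of_mem (Set.mem_singleton y)
  · rw [translateInd_one_of_not_mem (fun h => hy (Finset.mem_coe.1 h))]
    exact Finset.sum_eq_zero fun t ht => translateInd_one_of_not_mem fun h => by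
      rw [Set.mem_singleton_iff] at h; exact hy (h ▸ ht)

/-- `w • e_x = 𝟙_T + Σ_{t ∈ T} (e_x − e_t)` for a finset `T ∋ x` with `|T| = w`. [folklore] -/
private theorem card_smul_translateInd_singleton_eq (Tf : Finset E) (x : E) :
    (Tf.card : ℚ) • translateInd ({x} : Set E) (1 : G) =
      translateInd (Tf : Set E) (1 : G) +
        ∑ t ∈ Tf, (translateInd ({x} : Set E) (1 : G) - translateInd ({t} : Set E) (1 : G)) := by
  funext y
  rw [Pi.smul_apply, Pi.add_apply, Finset.sum_apply, smul_eq_mul]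
  simp only [Pi.sub_apply, Finset.sum_sub_distrib, Finset.sum_const, nsmul_eq_mul]
  rw [sum_translateInd_singleton_apply]
  ring

/-- **The indicators of the `w`-subsets of a finite set `E₀` (`0 < w < |E₀|`) span the functions supported on
`E₀`; in particular a subspace containing them contains every `e_x`, `x ∈ E₀`** ("the `n` vectors … are linearly
independent in `ℤ[ℤ₂ⁿ]`"). [cite: Dodson1987, Prop. 2.1 (proof)] -/
theorem translateInd_singleton_mem_of_forall_ncard [Finite E] (S : Submodule ℚ (E → ℚ)) {w : ℕ}
    (hw0 : 0 < w) (hwn : w < E₀.ncard)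
    (hS : ∀ T : Set E, T ⊆ E₀ → T.ncard = w → translateInd T (1 : G) ∈ S) {x : E} (hx : x ∈ E₀) :
    translateInd ({x} : Set E) (1 : G) ∈ S := by
  classical
  -- differences `e_u − e_v`, `u ≠ v ∈ E₀`, lie in `S`
  have hdiff : ∀ u v : E, u ∈ E₀ → v ∈ E₀ → u ≠ v →
      translateInd ({u} : Set E) (1 : G) - translateInd ({v} : Set E) (1 : G) ∈ S := by
    intro u v hu hv huv
    have hcard : w - 1 ≤ (E₀ \ {u, v}).ncard := by
      have h1 : (E₀ \ {u, v}).ncard + ({u, v} : Set E).ncard = E₀.ncard := by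
        rw [Set.ncard_sdiff_add_ncard_of_subset (by
          intro z hz; rcases hz with rfl | rfl; exacts [hu, hv]) (Set.toFinite E₀)]
      rw [Set.ncard_pair huv] at h1
      omega
    obtain ⟨R, hR, hRw⟩ := Set.exists_subset_card_eq hcard
    have huR : u ∉ R := fun h => by have := hR h; simp at this
    have hvR : v ∉ R := fun h => by have := hR h; simp at this
    have hRE : R ⊆ E₀ := hR.trans Set.sdiff_subset
    have hRfin : R.Finite := Set.toFinite R
    have hTu : translateInd (insert u R) (1 : G) ∈ S :=
      hS _ (Set.insert_subset hu hRE) (by rw [Set.ncard_insert_of_notMem huR hRfin, hRw]; omega)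
    have hTv : translateInd (insert v R) (1 : G) ∈ S :=
      hS _ (Set.insert_subset hv hRE) (by rw [Set.ncard_insert_of_notMem hvR hRfin, hRw]; omega)
    have := S.sub_mem hTu hTv
    rwa [translateInd_insert_sub_translateInd_insert huR hvR huv] at this
  -- a `w`-subset `T ∋ x`
  have hcard : w - 1 ≤ (E₀ \ {x}).ncard := by
    have h1 : (E₀ \ {x}).ncard + 1 = E₀.ncard := by
      rw [← Set.ncard_singleton x, Set.ncard_sdiff_add_ncard_of_subset (Set.singleton_subset_iff.2 hx)
        (Set.toFinite E₀)]
    omega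
  obtain ⟨R, hR, hRw⟩ := Set.exists_subset_card_eq hcard
  have hxR : x ∉ R := fun h => by have := hR h; simp at this
  have hRE : R ⊆ E₀ := hR.trans Set.sdiff_subset
  obtain ⟨Tf, hTf⟩ := (Set.toFinite (insert x R)).exists_finset_coe
  have hTS : translateInd (Tf : Set E) (1 : G) ∈ S := by
    rw [hTf]
    exact hS _ (Set.insert_subset hx hRE) (by rw [Set.ncard_insert_of_notMem hxR (Set.toFinite R), hRw]; omega)
  have hxT : x ∈ Tf := by rw [← Finset.mem_coe, hTf]; exact Set.mem_insert x R
  have hTcard : Tf.card = w := by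
    rw [← Set.ncard_coe_finset, hTf, Set.ncard_insert_of_notMem hxR (Set.toFinite R), hRw]; omega
  have hsum : ∑ t ∈ Tf, (translateInd ({x} : Set E) (1 : G) - translateInd ({t} : Set E) (1 : G)) ∈ S := by
    refine S.sum_mem fun t ht => ?_
    by_cases htx : t = x
    · rw [htx, sub_self]; exact S.zero_mem
    · have htE : t ∈ E₀ := by
        have : t ∈ (Tf : Set E) := ht
        rw [hTf] at this
        rcases this with h | h
        · exact absurd h htx
        · exact hRE h
      exact hdiff x t hx htE (Ne.symm htx)
  have key := S.add_mem hTS hsum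
  rw [← card_smul_translateInd_singleton_eq Tf x, hTcard] at key
  have hw' : (w : ℚ) ≠ 0 := by exact_mod_cast hw0.ne'
  rwa [S.smul_mem_iff hw'] at key

/-! ### The rank of the `G₀`-translates of `f` is `n` when `G₀` is `|f|`-homogeneous on the block -/

/-- For `m ∈ G₀ = Stab(E₀)`: `m • y ∈ E₀ ↔ y ∈ E₀`. [folklore] -/
private theorem smul_mem_iff_of_mem_stabilizer {m : G} (hm : m ∈ MulAction.stabilizer G E₀) (y : E) :
    m • y ∈ E₀ ↔ y ∈ E₀ := by
  have hmE : m • E₀ = E₀ := hm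
  conv_lhs => rw [← hmE]
  exact Set.smul_mem_smul_set_iff

/-- **`r = n`: if `G₀ = Stab(E₀)` moves `f ⊆ E₀` (`0 < |f| < n = |E₀|`) onto EVERY subset of `E₀` of the same
size, the `G₀`-translates of `f` span the `n`-dimensional space of functions on `E₀`** (Dodson's `r` in the
constant weight criterion; for `G₀ ⊇ Aₙ` "the `n` vectors … are linearly independent in `ℤ[ℤ₂ⁿ]`", Dodson 1987,
proof of Prop. 2.1). [cite: Dodson1987, Prop. 2.1 (proof)] -/
theorem typeRank_stabilizer_eq_ncard_of_forall_exists_smul_set_eq [Finite E] {f : Set E} (hf : f ⊆ E₀)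
    (hw0 : f.Nonempty) (hwn : f.ncard < E₀.ncard)
    (hHom : ∀ T : Set E, T ⊆ E₀ → T.ncard = f.ncard → ∃ m ∈ MulAction.stabilizer G E₀, m • f = T) :
    typeRank (MulAction.stabilizer G E₀) f = E₀.ncard := by
  classical
  haveI : Fintype E := Fintype.ofFinite E
  set S := Submodule.span ℚ (Set.range fun m : MulAction.stabilizer G E₀ => translateInd f (m : G))
    with hS_def
  have hr : typeRank (MulAction.stabilizer G E₀) f = Module.finrank ℚ S := rfl
  set W := Submodule.span ℚ (Set.range fun x : E₀ => translateInd ({(x : E)} : Set E) (1 : G)) with hW_def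
  -- `dim W = n`
  have hWcard : Module.finrank ℚ W = E₀.ncard := by
    have hli : LinearIndependent ℚ (fun x : E₀ => translateInd ({(x : E)} : Set E) (1 : G)) := by
      have heq : (fun x : E₀ => translateInd ({(x : E)} : Set E) (1 : G)) =
          (fun x : E₀ => Pi.basisFun ℚ E (x : E)) := by
        funext x
        rw [translateInd_singleton_one, Pi.basisFun_apply]
      rw [heq]
      exact (Pi.basisFun ℚ E).linearIndependent.comp _ Subtype.val_injective
    rw [hW_def, finrank_span_eq_card hli, ← Nat.card_eq_fintype_card, Nat.card_coe_set_eq]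
  -- `S ≤ W`: a translate of `f` by an element of `G₀` is supported on `E₀`
  obtain ⟨E₀f, hE₀f⟩ := (Set.toFinite E₀).exists_finset_coe
  have hSW : S ≤ W := by
    rw [hS_def, Submodule.span_le]
    rintro _ ⟨m, rfl⟩
    change translateInd f (m : G) ∈ W
    have hdec : translateInd f (m : G) =
        ∑ x ∈ E₀f, translateInd f (m : G) x • translateInd ({x} : Set E) (1 : G) := by
      funext y
      rw [Finset.sum_apply]
      simp only [Pi.smul_apply, smul_eq_mul]
      by_cases hy : y ∈ E₀
      · have hyf : y ∈ E₀f := by rw [← Finset.mem_coe, hE₀f]; exact hy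
        rw [Finset.sum_eq_single_of_mem y hyf fun x _ hxy => by
          rw [translateInd_one_of_not_mem (by rw [Set.mem_singleton_iff]; exact Ne.symm hxy), mul_zero]]
        rw [translateInd_one_of_mem (Set.mem_singleton y), mul_one]
      · have hmy : (m : G) • y ∉ f := fun h1 => hy ((smul_mem_iff_of_mem_stabilizer m.2 y).1 (hf h1))
        rw [translateInd_of_not_mem hmy]
        symm
        refine Finset.sum_eq_zero fun x hx => ?_
        rw [translateInd_one_of_not_mem (fun h1 => hy ?_), mul_zero]
        rw [Set.mem_singleton_iff] at h1
        rw [h1, ← hE₀f]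
        exact hx
    rw [hdec]
    exact W.sum_mem fun x hx =>
      W.smul_mem _ (Submodule.subset_span ⟨⟨x, by rw [← hE₀f]; exact hx⟩, rfl⟩)
  -- `W ≤ S`: every `𝟙_T`, `T` a `|f|`-subset of `E₀`, is a translate; then every `e_x` is in `S`
  have hWS : W ≤ S := by
    rw [hW_def, Submodule.span_le]
    rintro _ ⟨⟨x, hx⟩, rfl⟩
    refine translateInd_singleton_mem_of_forall_ncard S hw0.ncard_pos hwn (fun T hT hTw => ?_) hx
    obtain ⟨m, hm, hmT⟩ := hHom T hT hTw
    rw [← translateInd_inv_eq_of_smul_set_eq hmT]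
    exact Submodule.subset_span ⟨⟨m, hm⟩⁻¹, rfl⟩
  rw [hr, le_antisymm hSW hWS, hWcard]

namespace IsCMTypeWith

/-- `0 < |E₀ ∖ Φ| < n` from `Φ ∩ E₀ ≠ ∅ ≠ E₀ ∖ Φ`. [folklore] -/
private theorem ncard_sdiff_lt [Finite E] (hne : (Φ ∩ E₀).Nonempty) : (E₀ \ Φ).ncard < E₀.ncard := by
  have h1 := Set.ncard_inter_add_ncard_sdiff_eq_ncard E₀ Φ (Set.toFinite E₀)
  have h2 : 0 < (E₀ ∩ Φ).ncard := (show (E₀ ∩ Φ).Nonempty by rwa [Set.inter_comm]).ncard_pos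
  omega

/-- **Unbalanced weight over a homogeneous block ⟹ NONDEGENERATE**: if `G₀ = Stab(E₀)` moves `f = E₀ ∖ Φ` onto every
subset of the block of the same size, `0 < |f| < n` and `2|f| ≠ n`, then `t(Φ) = n + 1` (`t = r + 1` with `r = n`).
[cite: Dodson1987, Prop. 2.1 (proof)] [cite: Dodson1984, §3.1.1 Theorem] -/
theorem typeRank_eq_of_forall_exists_smul_set_eq [Fintype E] [Finite G] [MulAction.IsPretransitive G E]
    (h : IsCMTypeWith ρ Φ) (h₀ : IsCMTypeWith ρ E₀) (hG : ∀ g : G, g • E₀ = E₀ ∨ g • E₀ = ρ • E₀)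
    (hHom : ∀ T : Set E, T ⊆ E₀ → T.ncard = (E₀ \ Φ).ncard → ∃ m ∈ MulAction.stabilizer G E₀, m • (E₀ \ Φ) = T)
    (hw0 : ¬ E₀ ⊆ Φ) (hwn : (Φ ∩ E₀).Nonempty) (hw : 2 * (E₀ \ Φ).ncard ≠ E₀.ncard) :
    typeRank G Φ = Fintype.card E / 2 + 1 := by
  classical
  haveI : Nonempty E := ⟨hwn.some⟩
  have key := h.typeRank_eq_typeRank_stabilizer_add_one h₀ hG hw hw0
  have hf0 : (E₀ \ Φ).Nonempty := by
    obtain ⟨x, hx, hxΦ⟩ := Set.not_subset.1 hw0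
    exact ⟨x, hx, hxΦ⟩
  rw [typeRank_stabilizer_eq_ncard_of_forall_exists_smul_set_eq Set.sdiff_subset hf0 (ncard_sdiff_lt hwn) hHom]
    at key
  have hn := two_mul_ncard_eq_card_of_cm (c := ρ) h₀.mem_iff
  rw [Nat.card_eq_fintype_card] at hn
  omega

/-- **Weight `n/2` over a homogeneous block ⟹ rank EXACTLY `n`** (degenerate of corank one: `t = r = n` — Dodson's
"in which case `t(Φ) = r` may also occur"; Weil's 1977 types balanced over the imaginary quadratic subfield).
[cite: Dodson1987, Prop. 2.1 (proof)] [cite: Dodson1984, §3.1.1 Theorem] -/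
theorem typeRank_eq_of_forall_exists_smul_set_eq_of_balanced [Fintype E] [Nonempty E] [Finite G]
    [MulAction.IsPretransitive G E] (h : IsCMTypeWith ρ Φ) (h₀ : IsCMTypeWith ρ E₀)
    (hG : ∀ g : G, g • E₀ = E₀ ∨ g • E₀ = ρ • E₀)
    (hHom : ∀ T : Set E, T ⊆ E₀ → T.ncard = (E₀ \ Φ).ncard → ∃ m ∈ MulAction.stabilizer G E₀, m • (E₀ \ Φ) = T)
    (hw : 2 * (E₀ \ Φ).ncard = E₀.ncard) :
    typeRank G Φ = Fintype.card E / 2 := by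
  classical
  have key := h.typeRank_eq_typeRank_stabilizer h₀ hG hw
  have hn := two_mul_ncard_eq_card_of_cm (c := ρ) h₀.mem_iff
  rw [Nat.card_eq_fintype_card] at hn
  have hpos : 0 < E₀.ncard := by
    have : 0 < Fintype.card E := Fintype.card_pos
    omega
  have hf0 : (E₀ \ Φ).Nonempty := Set.nonempty_of_ncard_ne_zero (by omega)
  have hlt : (E₀ \ Φ).ncard < E₀.ncard := by omega
  rw [typeRank_stabilizer_eq_ncard_of_forall_exists_smul_set_eq Set.sdiff_subset hf0 hlt hHom] at key
  omega

/-! ### Primitivity: the translates of such a type separate the embeddings (`n ≥ 3`) -/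

/-- A `w`-subset of `E₀` containing `u` and avoiding `v` (`1 ≤ w ≤ n − 1`). [folklore] -/
private theorem exists_subset_mem_not_mem [Finite E] {u v : E} (hu : u ∈ E₀) (hv : v ∈ E₀) (huv : u ≠ v) {w : ℕ}
    (hw1 : 1 ≤ w) (hwn : w + 1 ≤ E₀.ncard) : ∃ T : Set E, T ⊆ E₀ ∧ T.ncard = w ∧ u ∈ T ∧ v ∉ T := by
  have hpair : ({u, v} : Set E) ⊆ E₀ := by
    intro z hz; rcases hz with rfl | rfl; exacts [hu, hv]
  have hcard : w - 1 ≤ (E₀ \ {u, v}).ncard := by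
    have h1 := Set.ncard_sdiff_add_ncard_of_subset hpair (Set.toFinite E₀)
    rw [Set.ncard_pair huv] at h1
    omega
  obtain ⟨R, hR, hRw⟩ := Set.exists_subset_card_eq hcard
  have huR : u ∉ R := fun h1 => by have := hR h1; simp at this
  have hvR : v ∉ R := fun h1 => by have := hR h1; simp at this
  refine ⟨insert u R, Set.insert_subset hu (hR.trans Set.sdiff_subset), ?_, Set.mem_insert u R, ?_⟩
  · rw [Set.ncard_insert_of_notMem huR (Set.toFinite R), hRw]; omega
  · rw [Set.mem_insert_iff]; push Not; exact ⟨huv.symm, hvR⟩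

/-- A `w`-subset of `E₀` containing `u` and `v` (`2 ≤ w ≤ n`). [folklore] -/
private theorem exists_subset_mem_mem [Finite E] {u v : E} (hu : u ∈ E₀) (hv : v ∈ E₀) (huv : u ≠ v) {w : ℕ}
    (hw2 : 2 ≤ w) (hwn : w ≤ E₀.ncard) : ∃ T : Set E, T ⊆ E₀ ∧ T.ncard = w ∧ u ∈ T ∧ v ∈ T := by
  have hpair : ({u, v} : Set E) ⊆ E₀ := by
    intro z hz; rcases hz with rfl | rfl; exacts [hu, hv]
  have hcard : w - 2 ≤ (E₀ \ {u, v}).ncard := by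
    have h1 := Set.ncard_sdiff_add_ncard_of_subset hpair (Set.toFinite E₀)
    rw [Set.ncard_pair huv] at h1
    omega
  obtain ⟨R, hR, hRw⟩ := Set.exists_subset_card_eq hcard
  have huR : u ∉ R := fun h1 => by have := hR h1; simp at this
  have hvR : v ∉ R := fun h1 => by have := hR h1; simp at this
  have huR' : u ∉ insert v R := by rw [Set.mem_insert_iff]; push Not; exact ⟨huv, huR⟩
  refine ⟨insert u (insert v R), Set.insert_subset hu (Set.insert_subset hv (hR.trans Set.sdiff_subset)), ?_,
    Set.mem_insert u _, Set.mem_insert_of_mem u (Set.mem_insert v R)⟩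
  rw [Set.ncard_insert_of_notMem huR' (Set.toFinite _), Set.ncard_insert_of_notMem hvR (Set.toFinite R), hRw]
  omega

/-- A `w`-subset of `E₀` avoiding `u` and `v` (`w ≤ n − 2`). [folklore] -/
private theorem exists_subset_not_mem_not_mem [Finite E] {u v : E} (hu : u ∈ E₀) (hv : v ∈ E₀) (huv : u ≠ v)
    {w : ℕ} (hwn : w + 2 ≤ E₀.ncard) : ∃ T : Set E, T ⊆ E₀ ∧ T.ncard = w ∧ u ∉ T ∧ v ∉ T := by
  have hpair : ({u, v} : Set E) ⊆ E₀ := by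
    intro z hz; rcases hz with rfl | rfl; exacts [hu, hv]
  have hcard : w ≤ (E₀ \ {u, v}).ncard := by
    have h1 := Set.ncard_sdiff_add_ncard_of_subset hpair (Set.toFinite E₀)
    rw [Set.ncard_pair huv] at h1
    omega
  obtain ⟨T, hT, hTw⟩ := Set.exists_subset_card_eq hcard
  exact ⟨T, hT.trans Set.sdiff_subset, hTw, fun h1 => by have := hT h1; simp at this,
    fun h1 => by have := hT h1; simp at this⟩

/-- **Every `w`-subset of the block is a trace**: for `T ⊆ E₀` with `|T| = |f|` there is `g ∈ G` with
`{z ∈ E₀ | gz ∈ Φ} = T` (namely `g = ρm⁻¹` with `mf = T`, `m ∈ G₀`; "the `G`-orbit of `f` is `G₀*(f) ∪ G₀*(ρf)`").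
[cite: Dodson1984, §3.1.1 Theorem (proof)] -/
theorem exists_forall_smul_mem_iff_of_forall_exists_smul_set_eq (h : IsCMTypeWith ρ Φ)
    (hHom : ∀ T : Set E, T ⊆ E₀ → T.ncard = (E₀ \ Φ).ncard → ∃ m ∈ MulAction.stabilizer G E₀, m • (E₀ \ Φ) = T)
    {T : Set E} (hT : T ⊆ E₀) (hTw : T.ncard = (E₀ \ Φ).ncard) :
    ∃ g : G, ∀ z ∈ E₀, (g • z ∈ Φ ↔ z ∈ T) := by
  obtain ⟨m, hm, hmT⟩ := hHom T hT hTw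
  refine ⟨ρ * m⁻¹, fun z hz => ?_⟩
  have hmz : m⁻¹ • z ∈ E₀ := (smul_mem_iff_of_mem_stabilizer (inv_mem hm) z).2 hz
  rw [mul_smul, h.rho_smul_mem_iff, ← hmT, Set.mem_smul_set_iff_inv_smul_mem, Set.mem_sdiff]
  exact ⟨fun h1 => ⟨hmz, h1⟩, fun h1 => h1.2⟩

/-- **A type of weight `0 < w < n` over a `|f|`-homogeneous block is PRIMITIVE when `n ≥ 3`** (its translates
separate the embeddings — Shimura's criterion `isPrimitive_iff_forall_eq`; every `w`-subset of the block is a trace).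
For `n = 2`, `w = 1` this fails (biquadratic CM fields).
[cite: Dodson1987, Prop. 2.1 (proof)] [cite: Shimura1998, §8.2 Prop. 26] -/
theorem isPrimitive_of_forall_exists_smul_set_eq [MulAction.IsPretransitive G E] [Finite E]
    (h : IsCMTypeWith ρ Φ) (h₀ : IsCMTypeWith ρ E₀)
    (hHom : ∀ T : Set E, T ⊆ E₀ → T.ncard = (E₀ \ Φ).ncard → ∃ m ∈ MulAction.stabilizer G E₀, m • (E₀ \ Φ) = T)
    (hw0 : ¬ E₀ ⊆ Φ) (hwn : (Φ ∩ E₀).Nonempty) (h3 : 3 ≤ E₀.ncard) (φh : E) : IsPrimitive G Φ φh := by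
  classical
  rw [isPrimitive_iff_forall_eq]
  set w := (E₀ \ Φ).ncard with hw_def
  have hw1 : 1 ≤ w := by
    obtain ⟨x, hx, hxΦ⟩ := Set.not_subset.1 hw0
    exact (show (E₀ \ Φ).Nonempty from ⟨x, hx, hxΦ⟩).ncard_pos
  have hwlt : w + 1 ≤ E₀.ncard := ncard_sdiff_lt hwn
  -- traces
  have key : ∀ T : Set E, T ⊆ E₀ → T.ncard = w → ∃ g : G, ∀ z ∈ E₀, (g • z ∈ Φ ↔ z ∈ T) :=
    fun T hT hTw => h.exists_forall_smul_mem_iff_of_forall_exists_smul_set_eq hHom hT hTw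
  -- outside the block, membership of `g • y` is the negation of membership of `g • ρy`
  have flip : ∀ (g : G) (y : E), g • y ∈ Φ ↔ g • ρ • y ∉ Φ := fun g y => by
    rw [h.comm]; exact h.mem_iff (g • y)
  -- the mixed case `x ∈ E₀`, `y ∉ E₀`
  have mixed : ∀ x y : E, x ∈ E₀ → y ∉ E₀ → (∀ g : G, g • x ∈ Φ ↔ g • y ∈ Φ) → False := by
    intro x y hx hy hxy
    have hρy : ρ • y ∈ E₀ := (h₀.rho_smul_mem_iff y).2 hy
    by_cases hρyx : ρ • y = x
    · have h1 := hxy 1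
      rw [one_smul, one_smul] at h1
      have h2 := flip 1 y
      rw [one_smul, one_smul, hρyx] at h2
      by_cases hxΦ : x ∈ Φ
      · exact (h2.1 (h1.1 hxΦ)) hxΦ
      · exact hxΦ (h1.2 (h2.2 hxΦ))
    · by_cases hw2 : 2 ≤ w
      · -- a trace containing both `x` and `ρy`
        obtain ⟨T, hT, hTw, hxT, hρyT⟩ := exists_subset_mem_mem hx hρy (Ne.symm hρyx) hw2 (by omega)
        obtain ⟨g, hg⟩ := key T hT hTw
        have hgx : g • x ∈ Φ := (hg x hx).2 hxT
        have hgρy : g • ρ • y ∈ Φ := (hg (ρ • y) hρy).2 hρyT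
        exact ((flip g y).1 ((hxy g).1 hgx)) hgρy
      · -- `w = 1 ≤ n − 2`: a trace avoiding both `x` and `ρy`
        obtain ⟨T, hT, hTw, hxT, hρyT⟩ := exists_subset_not_mem_not_mem hx hρy (Ne.symm hρyx) (w := w) (by omega)
        obtain ⟨g, hg⟩ := key T hT hTw
        have hgx : g • x ∉ Φ := fun h1 => hxT ((hg x hx).1 h1)
        have hgρy : g • ρ • y ∉ Φ := fun h1 => hρyT ((hg (ρ • y) hρy).1 h1)
        exact hgx ((hxy g).2 ((flip g y).2 hgρy))
  intro x y hxy
  by_contra hne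
  by_cases hx : x ∈ E₀ <;> by_cases hy : y ∈ E₀
  · -- both in the block: a trace containing `x` and avoiding `y`
    obtain ⟨T, hT, hTw, hxT, hyT⟩ := exists_subset_mem_not_mem hx hy hne hw1 hwlt
    obtain ⟨g, hg⟩ := key T hT hTw
    exact hyT ((hg y hy).1 ((hxy g).1 ((hg x hx).2 hxT)))
  · exact mixed x y hx hy hxy
  · exact mixed y x hy hx fun g => (hxy g).symm
  · -- both outside: `ρx ≠ ρy ∈ E₀`
    have hρx : ρ • x ∈ E₀ := (h₀.rho_smul_mem_iff x).2 hx
    have hρy : ρ • y ∈ E₀ := (h₀.rho_smul_mem_iff y).2 hy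
    have hρne : ρ • y ≠ ρ • x := fun h1 => hne (by simpa only [h₀.invol] using (congrArg (fun w => ρ • w) h1).symm)
    obtain ⟨T, hT, hTw, hρyT, hρxT⟩ := exists_subset_mem_not_mem hρy hρx hρne hw1 hwlt
    obtain ⟨g, hg⟩ := key T hT hTw
    -- `g x ∈ Φ` (as `ρx ∉ T`), hence `g y ∈ Φ`, hence `g ρy ∉ Φ` — but `ρy ∈ T`
    have hgx : g • x ∈ Φ := (flip g x).2 fun h1 => hρxT ((hg (ρ • x) hρx).1 h1)
    exact ((flip g y).1 ((hxy g).1 hgx)) ((hg (ρ • y) hρy).2 hρyT)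

/-! ### The number of translates (the reflex degree): `C(n,a) + C(n,b)`, or `C(n, n/2)` -/

/-- The trace of the translate `mΦ`, `m ∈ G₀`: `mΦ ∩ E₀ = m(Φ ∩ E₀)`. [cite: Dodson1984, §3.1.1 Theorem (proof)] -/
theorem smul_set_inter_eq_of_mem_stabilizer {m : G} (hm : m ∈ MulAction.stabilizer G E₀) :
    m • Φ ∩ E₀ = m • (Φ ∩ E₀) := by
  have hmE : m • E₀ = E₀ := hm
  rw [Set.smul_set_inter, hmE]

/-- The trace of the translate `ρmΦ`, `m ∈ G₀`: `ρmΦ ∩ E₀ = m(E₀ ∖ Φ)`. [cite: Dodson1984, §3.1.1 Theorem (proof)] -/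
theorem rho_mul_smul_set_inter_eq_of_mem_stabilizer (h : IsCMTypeWith ρ Φ) {m : G}
    (hm : m ∈ MulAction.stabilizer G E₀) : (ρ * m) • Φ ∩ E₀ = m • (E₀ \ Φ) := by
  have hmE : m • E₀ = E₀ := hm
  rw [mul_smul, (h.smul_set m).rho_smul_set_eq_compl, Set.smul_set_sdiff, hmE, ← Set.sdiff_eq_compl_inter]

/-- Core of the count from below: when `G₀` is `b`-homogeneous on the block, every `a`-subset and every `b`-subset
of (a finset copy of) the block is the trace of a translate of `Φ` (`a = |Φ ∩ E₀|`, `b = |E₀ ∖ Φ|`).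
[cite: Dodson1984, §3.1.1 Theorem (proof); §1.3 Remark] -/
private theorem card_union_le_card_orbit [Finite E] [DecidableEq E] (h : IsCMTypeWith ρ Φ)
    (hHom : ∀ T : Set E, T ⊆ E₀ → T.ncard = (E₀ \ Φ).ncard → ∃ m ∈ MulAction.stabilizer G E₀, m • (E₀ \ Φ) = T)
    (E₀f : Finset E) (hE₀f : (E₀f : Set E) = E₀) :
    (E₀f.powersetCard (Φ ∩ E₀).ncard ∪ E₀f.powersetCard (E₀ \ Φ).ncard).card ≤
      Nat.card (MulAction.orbit G Φ) := by
  classical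
  set T := E₀f.powersetCard (Φ ∩ E₀).ncard ∪ E₀f.powersetCard (E₀ \ Φ).ncard with hT_def
  have htrace : ∀ Ψ : Set E, ((E₀f.filter fun x => x ∈ Ψ : Finset E) : Set E) = Ψ ∩ E₀ := fun Ψ => by
    ext x
    rw [Finset.coe_filter, Set.mem_setOf_eq, ← Finset.mem_coe, hE₀f, Set.mem_inter_iff, and_comm]
  -- a map from `T` to the orbit hitting every element: its trace is the given subset
  have hab : (Φ ∩ E₀).ncard + (E₀ \ Φ).ncard = E₀.ncard := by
    rw [Set.inter_comm]; exact Set.ncard_inter_add_ncard_sdiff_eq_ncard E₀ Φ (Set.toFinite E₀)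
  have key : ∀ S ∈ T, ∃ Ψ : MulAction.orbit G Φ, (Ψ : Set E) ∩ E₀ = (S : Set E) := by
    intro S hS
    rw [hT_def, Finset.mem_union, Finset.mem_powersetCard, Finset.mem_powersetCard] at hS
    have hSE : (S : Set E) ⊆ E₀ := by
      rw [← hE₀f]; rcases hS with hS | hS <;> exact Finset.coe_subset.2 hS.1
    rcases hS with ⟨-, hSa⟩ | ⟨-, hSb⟩
    · -- an `a`-subset: `S = m(Φ ∩ E₀)` with `m f = E₀ ∖ S`
      have hcS : (E₀ \ (S : Set E)).ncard = (E₀ \ Φ).ncard := by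
        have h1 := Set.ncard_sdiff_add_ncard_of_subset hSE (Set.toFinite E₀)
        rw [Set.ncard_coe_finset, hSa] at h1
        omega
      obtain ⟨m, hm, hmS⟩ := hHom _ Set.sdiff_subset hcS
      refine ⟨⟨m • Φ, MulAction.mem_orbit Φ m⟩, ?_⟩
      change m • Φ ∩ E₀ = (S : Set E)
      have hmE : m • E₀ = E₀ := hm
      have e1 : Φ ∩ E₀ = E₀ \ (E₀ \ Φ) := by rw [sdiff_sdiff_right_self]; exact Set.inter_comm Φ E₀
      have e2 : E₀ \ (E₀ \ (S : Set E)) = (S : Set E) := by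
        rw [sdiff_sdiff_right_self]; exact Set.inter_eq_right.2 hSE
      rw [smul_set_inter_eq_of_mem_stabilizer hm, e1, Set.smul_set_sdiff, hmE, hmS, e2]
    · -- a `b`-subset: `S = m f`, the trace of `ρmΦ`
      obtain ⟨m, hm, hmS⟩ := hHom _ hSE (by rw [Set.ncard_coe_finset, hSb])
      refine ⟨⟨(ρ * m) • Φ, MulAction.mem_orbit Φ (ρ * m)⟩, ?_⟩
      change (ρ * m) • Φ ∩ E₀ = (S : Set E)
      rw [h.rho_mul_smul_set_inter_eq_of_mem_stabilizer hm, hmS]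
  choose Ψ hΨ using key
  let f : T → MulAction.orbit G Φ := fun S => Ψ S.1 S.2
  have hf : Function.Injective f := by
    rintro ⟨S, hS⟩ ⟨S', hS'⟩ hSS'
    have h1 : (Ψ S hS : Set E) ∩ E₀ = (Ψ S' hS' : Set E) ∩ E₀ := by
      change (f ⟨S, hS⟩ : Set E) ∩ E₀ = (f ⟨S', hS'⟩ : Set E) ∩ E₀
      rw [hSS']
    rw [hΨ S hS, hΨ S' hS'] at h1
    exact Subtype.ext (Finset.coe_injective h1)
  calc T.card = Nat.card T := by rw [Nat.card_eq_fintype_card, Fintype.card_coe]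
    _ ≤ Nat.card (MulAction.orbit G Φ) := Nat.card_le_card_of_injective f hf

/-- **`|G • Φ| = C(n,a) + C(n,b)`** for a type with multiplicities `(a, b)`, `a ≠ b`, over a `b`-homogeneous block
(equality in Dodson's "`G₀*(f) ∪ G₀*(ρf)`" bound; `[K′(Φ) : ℚ]` "is also the order of the orbit of `Φ`" — the term
`2·C(n,w)` of the partition `2ⁿ = Σ [K′ᵢ : ℚ]` for "`⟨ρ⟩ × Sₙ`").
[cite: Dodson1984, §3.1.1 Theorem (proof); §1.3 Remark; §4.0] -/
theorem card_orbit_eq_choose_add_choose_of_forall_exists_smul_set_eq [Finite E] (h : IsCMTypeWith ρ Φ)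
    (h₀ : IsCMTypeWith ρ E₀) (hG : ∀ g : G, g • E₀ = E₀ ∨ g • E₀ = ρ • E₀)
    (hHom : ∀ T : Set E, T ⊆ E₀ → T.ncard = (E₀ \ Φ).ncard → ∃ m ∈ MulAction.stabilizer G E₀, m • (E₀ \ Φ) = T)
    (hab : (Φ ∩ E₀).ncard ≠ (E₀ \ Φ).ncard) :
    Nat.card (MulAction.orbit G Φ) = (E₀.ncard).choose (Φ ∩ E₀).ncard + (E₀.ncard).choose (E₀ \ Φ).ncard := by
  classical
  obtain ⟨E₀f, hE₀f⟩ := (Set.toFinite E₀).exists_finset_coe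
  refine le_antisymm (h.card_orbit_le_choose_add_choose h₀ hG) ?_
  have hn : E₀.ncard = E₀f.card := by rw [← hE₀f, Set.ncard_coe_finset]
  rw [hn]
  have h1 := h.card_union_le_card_orbit hHom E₀f hE₀f
  have hdisj : Disjoint (E₀f.powersetCard (Φ ∩ E₀).ncard) (E₀f.powersetCard (E₀ \ Φ).ncard) :=
    Finset.disjoint_left.2 fun S hS hS' => hab (by
      rw [Finset.mem_powersetCard] at hS hS'
      rw [← hS.2, hS'.2])
  rwa [Finset.card_union_of_disjoint hdisj, Finset.card_powersetCard, Finset.card_powersetCard] at h1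

/-- **Balanced case `a = b = n/2`: `|G • Φ| = C(n, n/2)`** (the term of the partition for the types balanced over the
imaginary quadratic subfield). [cite: Dodson1984, §3.1.1 Theorem (proof); §1.3 Remark; §4.0] -/
theorem card_orbit_eq_choose_of_forall_exists_smul_set_eq [Finite E] (h : IsCMTypeWith ρ Φ)
    (h₀ : IsCMTypeWith ρ E₀) (hG : ∀ g : G, g • E₀ = E₀ ∨ g • E₀ = ρ • E₀)
    (hHom : ∀ T : Set E, T ⊆ E₀ → T.ncard = (E₀ \ Φ).ncard → ∃ m ∈ MulAction.stabilizer G E₀, m • (E₀ \ Φ) = T)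
    (hab : (Φ ∩ E₀).ncard = (E₀ \ Φ).ncard) :
    Nat.card (MulAction.orbit G Φ) = (E₀.ncard).choose (Φ ∩ E₀).ncard := by
  classical
  obtain ⟨E₀f, hE₀f⟩ := (Set.toFinite E₀).exists_finset_coe
  refine le_antisymm (h.card_orbit_le_choose h₀ hG hab) ?_
  have hn : E₀.ncard = E₀f.card := by rw [← hE₀f, Set.ncard_coe_finset]
  rw [hn]
  have h1 := h.card_union_le_card_orbit hHom E₀f hE₀f
  rwa [← hab, Finset.union_idempotent, Finset.card_powersetCard] at h1

/-! ### `G₀ ⊇ Alt(E₀)` is `k`-homogeneous on the block for every `k` (`n ≥ 3`) -/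

open scoped Classical in
/-- **If the image of `G₀` in `Sym(E₀)` contains the alternating group and `n ≥ 3`, `G₀` moves any subset of the
block onto any other of the same size** (Mathlib: `Alt(E₀)` is transitive on `k`-subsets,
`Set.powersetCard.isPretransitive_alternatingGroup`). [cite: Dodson1987, Prop. 2.1 (proof)] -/
theorem exists_mem_stabilizer_smul_set_eq_of_alternatingGroup_le [Finite E]
    (hA : letI : Fintype E₀ := Fintype.ofFinite E₀
      alternatingGroup E₀ ≤ (MulAction.toPermHom (MulAction.stabilizer G E₀) E₀).range)
    (h3 : 3 ≤ E₀.ncard) {T T' : Set E} (hT : T ⊆ E₀) (hT' : T' ⊆ E₀) (hTT' : T.ncard = T'.ncard) :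
    ∃ m ∈ MulAction.stabilizer G E₀, m • T = T' := by
  letI : Fintype E₀ := Fintype.ofFinite E₀
  set k := T'.ncard with hk
  -- the two subsets as `k`-combinations of the subtype `E₀`
  set s : Finset E₀ := Finset.univ.filter fun x : E₀ => (x : E) ∈ T with hs_def
  set s' : Finset E₀ := Finset.univ.filter fun x : E₀ => (x : E) ∈ T' with hs'_def
  have hcard : ∀ (U : Set E), U ⊆ E₀ → (Finset.univ.filter fun x : E₀ => (x : E) ∈ U).card = U.ncard := by
    intro U hU
    rw [← Set.ncard_coe_finset]
    have : ((Finset.univ.filter fun x : E₀ => (x : E) ∈ U : Finset E₀) : Set E₀) = Subtype.val ⁻¹' U := by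
      ext x; simp
    rw [this, Set.ncard_preimage_of_injective_subset_range Subtype.val_injective (by rwa [Subtype.range_coe])]
  have hs : s ∈ Set.powersetCard E₀ k := Set.powersetCard.mem_iff.2 (by rw [hs_def, hcard T hT, hTT'])
  have hs' : s' ∈ Set.powersetCard E₀ k := Set.powersetCard.mem_iff.2 (by rw [hs'_def, hcard T' hT'])
  have h3' : 3 ≤ Nat.card E₀ := by rwa [Nat.card_coe_set_eq]
  haveI := Set.powersetCard.isPretransitive_alternatingGroup (α := E₀) (n := k) h3'
  obtain ⟨σ, hσ⟩ := MulAction.exists_smul_eq (alternatingGroup E₀) (⟨s, hs⟩ : Set.powersetCard E₀ k) ⟨s', hs'⟩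
  have hσs : σ • s = s' := congrArg Subtype.val hσ
  obtain ⟨m, hm⟩ := hA σ.2
  have hσx : ∀ x : E₀, (m : G) • (x : E) = ((σ.1 x : E₀) : E) := fun x => by
    have h1 : (MulAction.toPermHom (MulAction.stabilizer G E₀) E₀ m) x = (σ : Equiv.Perm E₀) x := by rw [hm]
    have h2 := congrArg Subtype.val h1
    rw [MulAction.toPermHom_apply, MulAction.toPerm_apply, SMul.smul_stabilizer_def] at h2
    exact h2
  refine ⟨m, m.2, Set.eq_of_subset_of_ncard_le ?_ ?_ (Set.toFinite T')⟩
  · rintro _ ⟨t, ht, rfl⟩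
    change (m : G) • t ∈ T'
    have hxs : (⟨t, hT ht⟩ : E₀) ∈ s := by rw [hs_def, Finset.mem_filter]; exact ⟨Finset.mem_univ _, ht⟩
    have h1 : σ • (⟨t, hT ht⟩ : E₀) ∈ s' := by rw [← hσs]; exact Finset.smul_mem_smul_finset hxs
    rw [hs'_def, Finset.mem_filter] at h1
    have h2 : (m : G) • t = ((σ.1 ⟨t, hT ht⟩ : E₀) : E) := hσx ⟨t, hT ht⟩
    rw [h2]
    exact h1.2
  · rw [Set.ncard_smul_set, hTT']

open scoped Classical in
/-- **`n! ∣ |G|` ⟹ the image of `G₀` in `Sym(E₀)` contains `Alt(E₀)`**: `G₀` embeds in `Sym(E₀)` (faithful action,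
`|G| = 2|G₀|`), so `|G₀| ∈ {n!/2, n!}` and a subgroup of index `≤ 2` of `Sym(E₀)` contains the alternating group
(Mathlib `Equiv.Perm.eq_alternatingGroup_of_index_eq_two`) — "`Gal(K₀ᶜ/ℚ) ≅ Aₙ, or Sₙ`".
[cite: Dodson1987, Prop. 2.1] -/
theorem alternatingGroup_le_range_of_factorial_dvd [FaithfulSMul G E] [Finite E] [Finite G] [Nonempty E]
    (h₀ : IsCMTypeWith ρ E₀) (hG : ∀ g : G, g • E₀ = E₀ ∨ g • E₀ = ρ • E₀)
    (hfac : (E₀.ncard).factorial ∣ Nat.card G) :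
    letI : Fintype E₀ := Fintype.ofFinite E₀
    alternatingGroup E₀ ≤ (MulAction.toPermHom (MulAction.stabilizer G E₀) E₀).range := by
  classical
  letI : Fintype E₀ := Fintype.ofFinite E₀
  haveI := h₀.faithfulSMul_stabilizer_of_block
  have hinj : Function.Injective (MulAction.toPermHom (MulAction.stabilizer G E₀) E₀) :=
    MulAction.toPerm_injective
  set R := (MulAction.toPermHom (MulAction.stabilizer G E₀) E₀).range with hR
  have hcardR : Nat.card R = Nat.card (MulAction.stabilizer G E₀) :=
    (Nat.card_congr (MonoidHom.ofInjective hinj).toEquiv).symm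
  have hperm : Nat.card (Equiv.Perm E₀) = (E₀.ncard).factorial := by
    rw [Nat.card_perm, Nat.card_coe_set_eq]
  have h2 := h₀.card_eq_two_mul_card_stabilizer_of_block hG
  have hidx := R.index_mul_card
  rw [hcardR, hperm] at hidx
  -- `index · |G₀| = n!` and `n! ∣ 2|G₀|` give `index ∣ 2`
  have hpos : 0 < Nat.card (MulAction.stabilizer G E₀) := Nat.card_pos
  have hdvd : R.index ∣ 2 := by
    rw [h2, ← hidx] at hfac
    exact Nat.dvd_of_mul_dvd_mul_right hpos hfac
  rcases (Nat.dvd_prime Nat.prime_two).1 hdvd with h1 | h1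
  · rw [Subgroup.index_eq_one] at h1
    rw [h1]
    exact le_top
  · exact le_of_eq (Equiv.Perm.eq_alternatingGroup_of_index_eq_two h1).symm

/-! ### The two types of the block itself are not primitive (`n ≥ 2`) -/

/-- A type all of whose translates are `E₀` or `ρE₀ = E₀ᶜ` does not separate two points of the block, so it is NOT
primitive once `n ≥ 2` (the two types "having `D` as a reflex field" are induced from `D`).
[cite: Dodson1984, §3.1.1 Theorem (proof)] [cite: Shimura1998, §8.2 Prop. 26] -/
theorem not_isPrimitive_of_forall_smul_set_eq_or [MulAction.IsPretransitive G E] [Finite E]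
    (h₀ : IsCMTypeWith ρ E₀) (hΦ : ∀ g : G, g • Φ = E₀ ∨ g • Φ = ρ • E₀) (h2 : 2 ≤ E₀.ncard) (φh : E) :
    ¬ IsPrimitive G Φ φh := by
  rw [isPrimitive_iff_forall_eq]
  intro hsep
  obtain ⟨x, y, hx, hy, hxy⟩ := (Set.one_lt_ncard_iff (Set.toFinite E₀)).1 (by omega)
  refine hxy (hsep x y fun g => ?_)
  rw [← Set.mem_inv_smul_set_iff, ← Set.mem_inv_smul_set_iff]
  rcases hΦ g⁻¹ with h1 | h1
  · rw [h1]; exact ⟨fun _ => hy, fun _ => hx⟩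
  · rw [h1, h₀.rho_smul_set_eq_compl, Set.mem_compl_iff, Set.mem_compl_iff]
    exact ⟨fun h3 => absurd hx h3, fun h3 => absurd hy h3⟩

/-- A CM type containing the block IS the block. [cite: Dodson1984, §1.2 Proposition] -/
theorem eq_of_block_subset (h : IsCMTypeWith ρ Φ) (h₀ : IsCMTypeWith ρ E₀) (hsub : E₀ ⊆ Φ) : Φ = E₀ :=
  h.eq_of_inter_eq h₀ h₀ (by rw [Set.inter_eq_right.2 hsub, Set.inter_self])

/-- A CM type disjoint from the block is the conjugate block `ρE₀`. [cite: Dodson1984, §1.2 Proposition] -/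
theorem eq_rho_smul_of_inter_block_eq_empty (h : IsCMTypeWith ρ Φ) (h₀ : IsCMTypeWith ρ E₀)
    (hdis : Φ ∩ E₀ = ∅) : Φ = ρ • E₀ :=
  h.eq_of_inter_eq (h₀.smul_set ρ) h₀ (by rw [hdis, h₀.rho_smul_set_eq_compl, Set.compl_inter_self])

/-- **The block `E₀` (the type induced from the imaginary quadratic subfield) is not primitive** (`n ≥ 2`).
[cite: Dodson1984, §3.1.1 Theorem (proof)] -/
theorem not_isPrimitive_block [MulAction.IsPretransitive G E] [Finite E] (h₀ : IsCMTypeWith ρ E₀)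
    (hG : ∀ g : G, g • E₀ = E₀ ∨ g • E₀ = ρ • E₀) (h2 : 2 ≤ E₀.ncard) (φh : E) : ¬ IsPrimitive G E₀ φh :=
  h₀.not_isPrimitive_of_forall_smul_set_eq_or hG h2 φh

/-- **A PRIMITIVE type has weight `0 < |E₀ ∖ Φ| < n` over the block** (it is neither `E₀` nor `ρE₀`), `n ≥ 2`.
[cite: Dodson1984, §3.1.1 Theorem (proof)] -/
theorem not_subset_and_inter_nonempty_of_isPrimitive [MulAction.IsPretransitive G E] [Finite E]
    (h : IsCMTypeWith ρ Φ) (h₀ : IsCMTypeWith ρ E₀) (hG : ∀ g : G, g • E₀ = E₀ ∨ g • E₀ = ρ • E₀)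
    (h2 : 2 ≤ E₀.ncard) {φh : E} (hP : IsPrimitive G Φ φh) : ¬ E₀ ⊆ Φ ∧ (Φ ∩ E₀).Nonempty := by
  constructor
  · intro hsub
    rw [h.eq_of_block_subset h₀ hsub] at hP
    exact h₀.not_isPrimitive_block hG h2 φh hP
  · rw [Set.nonempty_iff_ne_empty]
    intro hdis
    rw [h.eq_rho_smul_of_inter_block_eq_empty h₀ hdis] at hP
    refine h₀.not_isPrimitive_of_forall_smul_set_eq_or (Φ := ρ • E₀) (fun g => ?_) h2 φh hP
    rw [smul_smul]
    rcases hG (g * ρ) with h1 | h1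
    · exact Or.inl h1
    · exact Or.inr h1

/-! ### Packaging with the hypothesis `n! ∣ |G|` ("`Gal(K₀ᶜ/ℚ) ≅ Aₙ or Sₙ`") -/

section Factorial

variable [FaithfulSMul G E] [Fintype E] [Finite G] [MulAction.IsPretransitive G E]

omit [MulAction.IsPretransitive G E] in
/-- `n! ∣ |G|`, `n ≥ 3` ⟹ `G₀` moves `E₀ ∖ Φ` onto every subset of the block of the same size.
[cite: Dodson1987, Prop. 2.1 (proof)] -/
theorem exists_smul_set_eq_of_factorial_dvd (h₀ : IsCMTypeWith ρ E₀) (hG : ∀ g : G, g • E₀ = E₀ ∨ g • E₀ = ρ • E₀)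
    (hfac : (E₀.ncard).factorial ∣ Nat.card G) (h3 : 3 ≤ E₀.ncard) (T : Set E) (hT : T ⊆ E₀)
    (hTw : T.ncard = (E₀ \ Φ).ncard) : ∃ m ∈ MulAction.stabilizer G E₀, m • (E₀ \ Φ) = T := by
  have hne : E₀.Nonempty := Set.nonempty_of_ncard_ne_zero (by omega)
  haveI : Nonempty E := ⟨hne.some⟩
  exact exists_mem_stabilizer_smul_set_eq_of_alternatingGroup_le (h₀.alternatingGroup_le_range_of_factorial_dvd hG hfac)
    h3 Set.sdiff_subset hT hTw.symm

/-- **Dodson 1987 Prop. 2.1, the computable case, EXACT form: `n! ∣ |G|` (`G₀ ⊇ Aₙ`), `n ≥ 3`, `Φ` of weight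
`0 < w < n` over the block with `2w ≠ n` ⟹ `Rank(Φ) = n + 1`.** [cite: Dodson1987, Prop. 2.1] -/
theorem typeRank_eq_of_factorial_dvd (h : IsCMTypeWith ρ Φ) (h₀ : IsCMTypeWith ρ E₀)
    (hG : ∀ g : G, g • E₀ = E₀ ∨ g • E₀ = ρ • E₀) (hfac : (E₀.ncard).factorial ∣ Nat.card G) (h3 : 3 ≤ E₀.ncard)
    (hw0 : ¬ E₀ ⊆ Φ) (hwn : (Φ ∩ E₀).Nonempty) (hw : 2 * (E₀ \ Φ).ncard ≠ E₀.ncard) :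
    typeRank G Φ = Fintype.card E / 2 + 1 :=
  h.typeRank_eq_of_forall_exists_smul_set_eq h₀ hG (h₀.exists_smul_set_eq_of_factorial_dvd hG hfac h3) hw0 hwn hw

/-- **… and weight `n/2` ⟹ `Rank(Φ) = n` exactly.** [cite: Dodson1987, Prop. 2.1 (proof)]
[cite: Dodson1984, §3.1.1 Theorem] -/
theorem typeRank_eq_of_factorial_dvd_of_balanced (h : IsCMTypeWith ρ Φ) (h₀ : IsCMTypeWith ρ E₀)
    (hG : ∀ g : G, g • E₀ = E₀ ∨ g • E₀ = ρ • E₀) (hfac : (E₀.ncard).factorial ∣ Nat.card G) (h3 : 3 ≤ E₀.ncard)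
    (hw : 2 * (E₀ \ Φ).ncard = E₀.ncard) : typeRank G Φ = Fintype.card E / 2 := by
  have hne : E₀.Nonempty := Set.nonempty_of_ncard_ne_zero (by omega)
  haveI : Nonempty E := ⟨hne.some⟩
  exact h.typeRank_eq_of_forall_exists_smul_set_eq_of_balanced h₀ hG (h₀.exists_smul_set_eq_of_factorial_dvd hG hfac h3)
    hw

/-- **… every type of weight `0 < w < n` is PRIMITIVE.** [cite: Dodson1987, Prop. 2.1 (proof)]
[cite: Shimura1998, §8.2 Prop. 26] -/
theorem isPrimitive_of_factorial_dvd (h : IsCMTypeWith ρ Φ) (h₀ : IsCMTypeWith ρ E₀)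
    (hG : ∀ g : G, g • E₀ = E₀ ∨ g • E₀ = ρ • E₀) (hfac : (E₀.ncard).factorial ∣ Nat.card G) (h3 : 3 ≤ E₀.ncard)
    (hw0 : ¬ E₀ ⊆ Φ) (hwn : (Φ ∩ E₀).Nonempty) (φh : E) : IsPrimitive G Φ φh :=
  h.isPrimitive_of_forall_exists_smul_set_eq h₀ (h₀.exists_smul_set_eq_of_factorial_dvd hG hfac h3) hw0 hwn h3 φh

/-- **For a PRIMITIVE type: nondegenerate ⟺ unbalanced over the block** (`n! ∣ |G|`, `n ≥ 3`); in particular for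
`n` odd every primitive type is nondegenerate (Dodson 1987 Prop. 2.1). [cite: Dodson1987, Prop. 2.1] -/
theorem typeRank_eq_iff_of_isPrimitive_of_factorial_dvd (h : IsCMTypeWith ρ Φ) (h₀ : IsCMTypeWith ρ E₀)
    (hG : ∀ g : G, g • E₀ = E₀ ∨ g • E₀ = ρ • E₀) (hfac : (E₀.ncard).factorial ∣ Nat.card G) (h3 : 3 ≤ E₀.ncard)
    {φh : E} (hP : IsPrimitive G Φ φh) :
    typeRank G Φ = Fintype.card E / 2 + 1 ↔ 2 * (E₀ \ Φ).ncard ≠ E₀.ncard := by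
  obtain ⟨hw0, hwn⟩ := h.not_subset_and_inter_nonempty_of_isPrimitive h₀ hG (by omega) hP
  refine ⟨fun hr hw => ?_, fun hw => h.typeRank_eq_of_factorial_dvd h₀ hG hfac h3 hw0 hwn hw⟩
  have h1 := h.typeRank_eq_of_factorial_dvd_of_balanced h₀ hG hfac h3 hw
  have hn := two_mul_ncard_eq_card_of_cm (c := ρ) h₀.mem_iff
  rw [Nat.card_eq_fintype_card] at hn
  omega

/-- **Dodson 1987, Prop. 2.1 (`K ⊇ k` imaginary quadratic): `n` ODD, `n! ∣ |G|` ⟹ every primitive type is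
nondegenerate.** [cite: Dodson1987, Prop. 2.1] -/
theorem typeRank_eq_of_isPrimitive_of_factorial_dvd_of_odd (h : IsCMTypeWith ρ Φ) (h₀ : IsCMTypeWith ρ E₀)
    (hG : ∀ g : G, g • E₀ = E₀ ∨ g • E₀ = ρ • E₀) (hfac : (E₀.ncard).factorial ∣ Nat.card G) (h3 : 3 ≤ E₀.ncard)
    (hodd : Odd E₀.ncard) {φh : E} (hP : IsPrimitive G Φ φh) : typeRank G Φ = Fintype.card E / 2 + 1 :=
  (h.typeRank_eq_iff_of_isPrimitive_of_factorial_dvd h₀ hG hfac h3 hP).2 fun hw => by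
    obtain ⟨k, hk⟩ := hodd; omega

omit [MulAction.IsPretransitive G E] in
/-- **The number of translates (= `[K′(Φ) : ℚ]`): `C(n,a) + C(n,b)` for `a ≠ b`**, `n! ∣ |G|`, `n ≥ 3`.
[cite: Dodson1984, §1.3 Remark; §4.0] -/
theorem card_orbit_eq_choose_add_choose_of_factorial_dvd (h : IsCMTypeWith ρ Φ) (h₀ : IsCMTypeWith ρ E₀)
    (hG : ∀ g : G, g • E₀ = E₀ ∨ g • E₀ = ρ • E₀) (hfac : (E₀.ncard).factorial ∣ Nat.card G) (h3 : 3 ≤ E₀.ncard)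
    (hab : (Φ ∩ E₀).ncard ≠ (E₀ \ Φ).ncard) :
    Nat.card (MulAction.orbit G Φ) = (E₀.ncard).choose (Φ ∩ E₀).ncard + (E₀.ncard).choose (E₀ \ Φ).ncard :=
  h.card_orbit_eq_choose_add_choose_of_forall_exists_smul_set_eq h₀ hG
    (h₀.exists_smul_set_eq_of_factorial_dvd hG hfac h3) hab

omit [MulAction.IsPretransitive G E] in
/-- **… and `C(n, n/2)` for `a = b`.** [cite: Dodson1984, §1.3 Remark; §4.0] -/
theorem card_orbit_eq_choose_of_factorial_dvd (h : IsCMTypeWith ρ Φ) (h₀ : IsCMTypeWith ρ E₀)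
    (hG : ∀ g : G, g • E₀ = E₀ ∨ g • E₀ = ρ • E₀) (hfac : (E₀.ncard).factorial ∣ Nat.card G) (h3 : 3 ≤ E₀.ncard)
    (hab : (Φ ∩ E₀).ncard = (E₀ \ Φ).ncard) :
    Nat.card (MulAction.orbit G Φ) = (E₀.ncard).choose (Φ ∩ E₀).ncard :=
  h.card_orbit_eq_choose_of_forall_exists_smul_set_eq h₀ hG (h₀.exists_smul_set_eq_of_factorial_dvd hG hfac h3) hab

end Factorial

end IsCMTypeWith

end GroupLevel

end Literature.NumberTheory.ComplexMultiplication
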